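import Summits.CriticalPhenomena.PercolationContinuityZ3.Theorems.PercNearOneGluingNoHeavyQuantGatedSliceMixLawPrime
import Summits.CriticalPhenomena.PercolationContinuityZ3.Theorems.PercNearOneGluingNoHeavyQuantGatedSliceWindowSDEC
import HarnessLib

/-!
# QUANT lane R8, T-DEC, leg (III), blob case — dual route, corrected assembly: **`GatedSliceMixLaw' → GatedSliceWindowDEC`** and
# **`GatedSliceMixLaw' → (SDECUpTo closed under slicing by any heavy blob)`**

builds on p205010 (kernel theorem, internal audit signed; external expert review pending)

Support file (`--supports stmt-CriticalPhenomena-4575`), QUANT lane typer seat prim-quant-stmt (gen 29), rung R8 of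
`run/shared/lean/prim/quant/LADDER.md`.  Theorems only, standard axioms, no sorries, no definitions.  `GatedSliceMixLaw` as typed is FALSE
(`not_gatedSliceMixLaw`, `…QuantGatedSliceMixLawRefutation`: a tight DEC weak-mid law sharing its only absorber); the reduction never needed that case — a weak mid
`h` means `⟨e, W_h⟩ > 0`, so `W_h ∉ D(t,j)` by weak duality — and the corrected conjecture `GatedSliceMixLaw'` (`…QuantGatedSliceMixLawPrime`) carries exactly that
hypothesis.  This file re-runs the weak-mid branch and the assembly of `…QuantGatedSliceWindowReduction` from `GatedSliceMixLaw'` (proofs verbatim plus the one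
weak-duality line) and composes with `sdecUpTo_slice_blob_of_window` (`…QuantGatedSliceWindowSDEC`).

* **`LawDec.gatedSlice_weakMid_functional_le'`**, **`LawDec.gatedSliceWindowDEC_of_mixLaw' : GatedSliceMixLaw' → GatedSliceWindowDEC`**,
  **`LawDec.sdecUpTo_slice_blob_of_mixLaw'`**, `LawDec.sdec_slice_blob_of_mixLaw'`.

[this work].  Gordan/Farkas [cite: Schrijver1986, Cor 7.1f (p. 90)].  The gluing rows served [cite: KozmaNitzan2024, Conjecture 3 (p. 15)]; product measure
[cite: Grimmett1999, §1.3 p. 10].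
-/

noncomputable section

namespace Summit.CriticalPhenomena.PercolationContinuityZ3.Theorems

namespace Quant

open Finset

/-- the two-point law `{lo, hi; g}` (as in `…QuantLawDEC`) -/
local notation3 "TP[" lo ", " hi ", " g ", " h "]" =>
  (g : ℝ) * (if (h : ℕ) = (hi : ℕ) then (1 : ℝ) else 0) + (1 - (g : ℝ)) * (if (h : ℕ) = (lo : ℕ) then (1 : ℝ) else 0)

namespace LawDec

/-! ### The weak-mid branch -/

/-- **A WEAK MID ⟹ THE PRICE INEQUALITY, from the corrected `GatedSliceMixLaw'`.**  As `gatedSlice_weakMid_functional_le`, but the mixing statement is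
only invoked after deriving `W_h ∉ D(t, j)` from `⟨e, W_h⟩ > 0` (weak duality).  Frame: `0 < y < 1`, `0 ≤ z ≤ ν 0`, `z < 1`, `g ≤ 1`, `y ≤ (1−z)g`,
`1 ≤ a`, `j < M + a`, `ν ≥ 0` a probability law on `{0..M}` with mean `S > 0`, `y·M ≤ S`; `(α, β)` a price system of `{0..M+a}` at
`(y, t, j)`, `t = S + ag(1−z)`; a WEAK MID `h ≤ min(j, M)`, `S < h`: `S·(−Φ h) < α 0·(h − S)` (`Φ = slicePullback t g j a α β`).  Then the value of
`(α, β)` on the moved law is `≤ 0`. [this work] -/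
theorem gatedSlice_weakMid_functional_le' (hL : GatedSliceMixLaw') (y z g S : ℝ) (a j M h : ℕ) (ν α β : ℕ → ℝ)
    (hy0 : 0 < y) (hy1 : y < 1) (hz0 : 0 ≤ z) (hz1 : z < 1) (hzν : z ≤ ν 0) (hg1 : g ≤ 1) (hyg : y ≤ (1 - z) * g) (ha : 1 ≤ a)
    (hjM : j < M + a) (hS0 : 0 < S) (hta : y * (M : ℝ) ≤ S)
    (hν0 : ∀ k, 0 ≤ ν k) (hνM : ∀ k, M < k → ν k = 0) (hν1 : ∑ k ∈ Finset.range (M + 1), ν k = 1)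
    (hS : S = ∑ k ∈ Finset.range (M + 1), (k : ℝ) * ν k)
    (hβ : ∀ p, 0 ≤ β p)
    (hαβ : ∀ l p, l ≤ j → 2 * (l : ℝ) < S + (a : ℝ) * g * (1 - z) → p ≤ M + a →
      (j + 1 ≤ p ∨ S + (a : ℝ) * g * (1 - z) < (l : ℝ) + p) → α l ≤ usage y (S + (a : ℝ) * g * (1 - z)) j l p * β p)
    (hhj : h ≤ j) (hhM : h ≤ M) (hSh : S < (h : ℝ))
    (hweak : S * (- slicePullback (S + (a : ℝ) * g * (1 - z)) g j a α β h) < α 0 * ((h : ℝ) - S)) :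
    ∑ p ∈ Finset.range (M + a + 1), coefAt (S + (a : ℝ) * g * (1 - z)) j α β p
      * (slice ν a g p + g * z * ((if p = 0 then (1 : ℝ) else 0) - (if p = a then (1 : ℝ) else 0))) ≤ 0 := by
  classical
  set t : ℝ := S + (a : ℝ) * g * (1 - z) with ht
  set e : ℕ → ℝ := coefAt t j α β with he
  have h1z : 0 < 1 - z := by linarith
  have hg0 : 0 < g := by
    by_contra hc
    linarith [mul_nonpos_of_nonneg_of_nonpos h1z.le (not_lt.1 hc)]
  have ht0 : 0 < t := by linarith [(by positivity : 0 < (a : ℝ) * g * (1 - z))]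
  have hh0 : (0 : ℝ) < h := lt_trans hS0 hSh
  -- ⟨e, W_h⟩ > 0
  have hW : 0 < ∑ p ∈ Finset.range (M + a + 1), e p * weakMidLaw S g h a p := by
    rw [sum_coef_weakMidLaw e S g h a (M + a) (by omega)]
    have e0 : e 0 = α 0 := by
      simp only [he, coefAt]
      rw [if_pos ⟨Nat.zero_le j, by simpa using ht0⟩]
    have eΦ : (1 - g) * e h + g * e (h + a) = slicePullback t g j a α β h := by
      simp only [he, slicePullback]
    rw [e0, eΦ]
    -- multiply the weak inequality by 1/h
    have key : 0 < α 0 * ((h : ℝ) - S) + S * slicePullback t g j a α β h := by linarith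
    have : (1 - S / h) * α 0 + S / h * slicePullback t g j a α β h
        = (α 0 * ((h : ℝ) - S) + S * slicePullback t g j a α β h) / h := by
      field_simp
    rw [this]
    exact div_pos key hh0
  -- a violated law is not DEC (weak duality): the extra hypothesis of `GatedSliceMixLaw'`
  have hWnd : ¬ DECAtT y t j (M + a) (weakMidLaw S g h a) := by
    intro hWdec
    have wdW := dual_le_of_decAtT y t j (M + a) _ hy0 hy1 hWdec α β hβ hαβ
    have wdW_eq := dual_functional_eq t j (M + a) α β (weakMidLaw S g h a) (by omega)
    have : ∑ p ∈ Finset.range (M + a + 1), coefAt t j α β p * weakMidLaw S g h a p ≤ 0 := by linarith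
    simp only [he] at hW
    linarith
  -- ν̂ = (ν − zδ₀)/(1−z)
  set μ : ℕ → ℝ := fun k => if k = 0 then (ν 0 - z) / (1 - z) else ν k / (1 - z) with hμ
  have hμ0 : ∀ k, 0 ≤ μ k := by
    intro k
    by_cases hk : k = 0
    · simp only [hμ, if_pos hk]; exact div_nonneg (by linarith) h1z.le
    · simp only [hμ, if_neg hk]; exact div_nonneg (hν0 k) h1z.le
  have hμM : ∀ k, M < k → μ k = 0 := fun k hk => by
    simp only [hμ, if_neg (show k ≠ 0 by omega), hνM k hk, zero_div]
  have hμν : ∀ k, (1 - z) * μ k = ν k - z * (if k = 0 then (1 : ℝ) else 0) := by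
    intro k
    by_cases hk : k = 0
    · subst hk
      simp only [hμ, if_true]
      field_simp
    · simp only [hμ, if_neg hk]
      field_simp
      ring
  have hμ1 : ∑ k ∈ Finset.range (M + 1), μ k = 1 := by
    have e1 : ∑ k ∈ Finset.range (M + 1), (1 - z) * μ k = 1 - z := by
      rw [Finset.sum_congr rfl (fun k _ => hμν k), Finset.sum_sub_distrib, hν1, ← Finset.mul_sum,
        Finset.sum_ite_eq' (Finset.range (M + 1)) 0 (fun _ => (1 : ℝ)), if_pos (Finset.mem_range.2 (Nat.succ_pos M))]
      ring
    rw [← Finset.mul_sum] at e1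
    exact mul_left_cancel₀ (ne_of_gt h1z) (e1.trans (mul_one (1 - z)).symm)
  have hμmean : (1 - z) * ∑ k ∈ Finset.range (M + 1), (k : ℝ) * μ k = S := by
    rw [Finset.mul_sum]
    have e1 : ∀ k ∈ Finset.range (M + 1), (1 - z) * ((k : ℝ) * μ k) = (k : ℝ) * ν k := by
      intro k _
      have := hμν k
      by_cases hk : k = 0
      · subst hk; simp
      · rw [if_neg hk] at this
        calc (1 - z) * ((k : ℝ) * μ k) = (k : ℝ) * ((1 - z) * μ k) := by ring
          _ = (k : ℝ) * ν k := by rw [this]; ring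
    rw [Finset.sum_congr rfl e1, hS]
  -- the moved law in terms of ν̂
  have hP : ∀ p, slice ν a g p + g * z * ((if p = 0 then (1 : ℝ) else 0) - (if p = a then (1 : ℝ) else 0))
      = z * (if p = 0 then (1 : ℝ) else 0) + (1 - z) * slice μ a g p := by
    intro p
    have hs : (1 - z) * slice μ a g p = slice ν a g p - z * slice (fun k => if k = 0 then (1 : ℝ) else 0) a g p := by
      simp only [slice]
      have e1 := hμν p
      by_cases hap : a ≤ p
      · rw [if_pos hap, if_pos hap, if_pos hap]
        have e2 := hμν (p - a)
        calc (1 - z) * ((1 - g) * μ p + g * μ (p - a))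
            = (1 - g) * ((1 - z) * μ p) + g * ((1 - z) * μ (p - a)) := by ring
          _ = _ := by rw [e1, e2]; ring
      · rw [if_neg hap, if_neg hap, if_neg hap]
        calc (1 - z) * ((1 - g) * μ p + g * 0) = (1 - g) * ((1 - z) * μ p) := by ring
          _ = _ := by rw [e1]; ring
    have ha0 : a ≠ 0 := by omega
    have hsδ : slice (fun k => if k = 0 then (1 : ℝ) else 0) a g p
        = (1 - g) * (if p = 0 then (1 : ℝ) else 0) + g * (if p = a then (1 : ℝ) else 0) := by
      simp only [slice]
      split_ifs <;> (first | (exfalso; omega) | ring)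
    rw [hsδ] at hs
    linarith
  -- two-point decomposition of ν̂
  obtain ⟨lam, gt, lo, hi, hl0, hl1, hgt, hlohi, hhi, hμeq, hgen⟩ := exists_twoPoint_decomposition M M le_rfl μ hμ0 hμM hμ1
  -- the moved two-point laws
  set Q : (Fin (M + 1) × Fin (M + 1)) → ℕ → ℝ := fun r p =>
    z * (if p = 0 then (1 : ℝ) else 0) + (1 - z) * slice (fun q => TP[lo r, hi r, gt r, q]) a g p with hQ
  have hPQ : ∀ p, slice ν a g p + g * z * ((if p = 0 then (1 : ℝ) else 0) - (if p = a then (1 : ℝ) else 0))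
      = ∑ r, lam r * Q r p := by
    intro p
    rw [hP p]
    have hsl : slice μ a g p = ∑ r, lam r * slice (fun q => TP[lo r, hi r, gt r, q]) a g p := by
      rw [← slice_mixture lam (fun r q => TP[lo r, hi r, gt r, q]) a g p]
      congr 1
      funext q
      exact hμeq q
    rw [hsl, Finset.mul_sum]
    have hz' : z * (if p = 0 then (1 : ℝ) else 0) = ∑ r, lam r * (z * (if p = 0 then (1 : ℝ) else 0)) := by
      rw [← Finset.sum_mul, hl1, one_mul]
    rw [hz', ← Finset.sum_add_distrib]
    refine Finset.sum_congr rfl fun r _ => ?_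
    simp only [hQ]
    ring
  -- each moved two-point law has value ≤ 0
  have hQle : ∀ r, 0 < lam r → ∑ p ∈ Finset.range (M + a + 1), e p * Q r p ≤ 0 := by
    intro r hr
    obtain ⟨_, _, hmean, _⟩ := hgen r hr
    have hmeanS : (1 - z) * ((lo r : ℝ) + ((hi r : ℝ) - lo r) * gt r) = S := by rw [hmean]; exact hμmean
    obtain ⟨θ, hθ0, hθ1, hdecθ⟩ := hL y z g S (gt r) a j M h (lo r) (hi r) hy0 hy1 hz0 hz1 hg1 hyg ha hjM hS0 hta hhj hhM hSh hWnd
      (hlohi r) (hhi r) (hgt r).1 (hgt r).2 hmeanS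
    have wd := dual_le_of_decAtT y t j (M + a) _ hy0 hy1 hdecθ α β hβ hαβ
    have wd_eq := dual_functional_eq t j (M + a) α β
      (fun p => θ * weakMidLaw S g h a p + (1 - θ) * Q r p) (by omega)
    have hsplit : ∑ p ∈ Finset.range (M + a + 1), coefAt t j α β p * (θ * weakMidLaw S g h a p + (1 - θ) * Q r p)
        = θ * ∑ p ∈ Finset.range (M + a + 1), e p * weakMidLaw S g h a p + (1 - θ) * ∑ p ∈ Finset.range (M + a + 1), e p * Q r p := by
      rw [Finset.mul_sum, Finset.mul_sum, ← Finset.sum_add_distrib]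
      refine Finset.sum_congr rfl fun p _ => ?_
      simp only [he]; ring
    have hle : θ * ∑ p ∈ Finset.range (M + a + 1), e p * weakMidLaw S g h a p
        + (1 - θ) * ∑ p ∈ Finset.range (M + a + 1), e p * Q r p ≤ 0 := by
      rw [← hsplit, ← wd_eq]; linarith
    have h1θ : 0 < 1 - θ := by linarith
    by_contra hc
    have hpos : 0 < ∑ p ∈ Finset.range (M + a + 1), e p * Q r p := not_le.1 hc
    nlinarith [mul_nonneg hθ0 hW.le, mul_pos h1θ hpos]
  -- sum up
  have htot : ∑ p ∈ Finset.range (M + a + 1), e p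
      * (slice ν a g p + g * z * ((if p = 0 then (1 : ℝ) else 0) - (if p = a then (1 : ℝ) else 0)))
      = ∑ r, lam r * ∑ p ∈ Finset.range (M + a + 1), e p * Q r p := by
    rw [Finset.sum_congr rfl (fun p _ => by rw [hPQ p])]
    simp_rw [Finset.mul_sum]
    rw [Finset.sum_comm]
    refine Finset.sum_congr rfl fun r _ => Finset.sum_congr rfl fun p _ => by ring
  rw [htot]
  refine Finset.sum_nonpos fun r _ => ?_
  rcases (hl0 r).eq_or_lt with hz' | hpos
  · rw [← hz', zero_mul]
  · exact mul_nonpos_of_nonneg_of_nonpos (hl0 r) (hQle r hpos)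


/-! ### The assembly -/

/-- **`GatedSliceMixLaw' → GatedSliceWindowDEC`**: the window form of the blob gate step follows from the CORRECTED law-level mixing statement
(same proof as `gatedSliceWindowDEC_of_mixLaw`, weak-mid branch via `gatedSlice_weakMid_functional_le'`).  Strong
duality for the moved law; the zero re-priced to `max(α 0, 0, α a)`; the single-layer layer `J` of `slicePullback_layer` (base target
`T₀ = S − zag`); no weak mid ⟹ `gatedSlice_noWeak_functional_le` with the window hypothesis at `J`; a weak mid ⟹
`gatedSlice_weakMid_functional_le`; `S = 0` ⟹ `ν = δ₀` and typer g27's `decAtT_gateMoveBlob`. [this work] -/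
theorem gatedSliceWindowDEC_of_mixLaw' (hL : GatedSliceMixLaw') : GatedSliceWindowDEC := by
  classical
  intro y z g S a j M ν hy0 hy1 hz0 hzν hg1 hyg ha hν0 hνM hν1 hS hta hjN hwin
  -- parameters
  have hν0le1 : ν 0 ≤ 1 := by
    have h0 := Finset.single_le_sum (fun h _ => hν0 h) (Finset.mem_range.2 (Nat.succ_pos M))
    rw [hν1] at h0; exact h0
  have hz1' : z ≤ 1 := hzν.trans hν0le1
  have hg0 : 0 < g := by
    by_contra hc
    linarith [mul_nonpos_of_nonneg_of_nonpos (by linarith : 0 ≤ 1 - z) (not_lt.1 hc)]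
  have hz1 : z < 1 := by
    by_contra hc
    linarith [mul_nonpos_of_nonpos_of_nonneg (by linarith : 1 - z ≤ 0) hg0.le]
  have hyg' : y ≤ g := hyg.trans (by nlinarith)
  have hS0' : 0 ≤ S := by rw [hS]; exact Finset.sum_nonneg (fun h _ => mul_nonneg (Nat.cast_nonneg h) (hν0 h))
  -- the moved law
  obtain ⟨hP0, hPM, hP1, hPt⟩ := moved_laws ν a M g z ha hg0.le hg1 hz0 hzν hν0 hνM hν1
  -- degenerate case S = 0: ν = δ₀
  rcases hS0'.eq_or_lt with hS0 | hS0
  · have hνk : ∀ k, 0 < k → ν k = 0 := by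
      intro k hk
      by_cases hkM : k ≤ M
      · have hall := (Finset.sum_eq_zero_iff_of_nonneg (fun h _ => mul_nonneg (Nat.cast_nonneg h) (hν0 h))).1
          (hS.symm.trans hS0.symm) k (Finset.mem_range.2 (Nat.lt_succ_of_le hkM))
        have hk' : (0 : ℝ) < k := by exact_mod_cast hk
        exact (mul_eq_zero.1 hall).resolve_left (ne_of_gt hk')
      · exact hνM k (not_le.1 hkM)
    have hΛ : DECAtT y (S + (a : ℝ) * g) j (M + a) (slice ν a g) :=
      sliceClosedWindowT_holds y g S M a j ν hy0 hy1 hyg' hg1 ha hν0 hνM hν1 hjN hwin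
    exact decAtT_gateMoveBlob y z g S a j M ν hy0 hy1 hz0 hg1 hyg ha hν0 hνM hν1 hS hta hzν
      (fun k hk _ => by rw [hνk k hk, mul_zero]) hΛ
  -- main case: rewrite the target as T₀ + a·g with T₀ = S − z·a·g
  have ht_eq : S + (a : ℝ) * g - z * (a : ℝ) * g = (S - z * (a : ℝ) * g) + (a : ℝ) * g := by ring
  rw [ht_eq]
  set T₀ : ℝ := S - z * (a : ℝ) * g with hT₀
  set P : ℕ → ℝ := fun h => slice ν a g h + g * z * ((if h = 0 then (1 : ℝ) else 0) - (if h = a then (1 : ℝ) else 0)) with hPdef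
  have hzag : 0 ≤ z * (a : ℝ) * g := mul_nonneg (mul_nonneg hz0 (Nat.cast_nonneg a)) hg0.le
  have hT₀S : T₀ ≤ S := by rw [hT₀]; linarith
  have ht_eq' : S + (a : ℝ) * g * (1 - z) = T₀ + (a : ℝ) * g := by rw [hT₀]; ring
  have ht0 : 0 < T₀ + (a : ℝ) * g := by
    rw [← ht_eq']
    have : 0 ≤ (a : ℝ) * g * (1 - z) := mul_nonneg (mul_nonneg (Nat.cast_nonneg a) hg0.le) (by linarith)
    linarith
  rw [decAtT_iff_prices y (T₀ + (a : ℝ) * g) j (M + a) P hy0 hy1 hPM hP1]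
  intro α β hβ hαβ
  -- raise the zero's price to A = max(α 0, 0, α a (if a is a low))
  set A : ℝ := max (max (α 0) 0) (if a ≤ j ∧ 2 * (a : ℝ) < T₀ + (a : ℝ) * g then α a else 0) with hA
  set α' : ℕ → ℝ := fun l => if l = 0 then A else α l with hα'
  have hα0A : α 0 ≤ A := (le_max_left _ _).trans (le_max_left _ _)
  have hA0 : 0 ≤ A := (le_max_right _ _).trans (le_max_left _ _)
  have hα'0 : α' 0 = A := by simp only [hα', if_pos rfl]
  have hαβ' : ∀ l p, l ≤ j → 2 * (l : ℝ) < T₀ + (a : ℝ) * g → p ≤ M + a →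
      (j + 1 ≤ p ∨ T₀ + (a : ℝ) * g < (l : ℝ) + p) → α' l ≤ usage y (T₀ + (a : ℝ) * g) j l p * β p := by
    intro l p hl hlow hp hcomp
    by_cases hl0 : l = 0
    · subst hl0
      rw [hα'0]
      have hcomp0 : j + 1 ≤ p ∨ T₀ + (a : ℝ) * g < (p : ℝ) := by
        rcases hcomp with hc | hc
        · exact Or.inl hc
        · exact Or.inr (by simpa using hc)
      have hp0 : 0 < p := by
        rcases hcomp0 with hc | hc
        · omega
        · exact_mod_cast (lt_trans ht0 hc : (0 : ℝ) < p)
      have hupos : 0 < usage y (T₀ + (a : ℝ) * g) j 0 p :=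
        usage_pos_of_compat y (T₀ + (a : ℝ) * g) j 0 p hy0 hy1 hlow hp0 hcomp
      refine max_le (max_le (hαβ 0 p hl hlow hp hcomp) (mul_nonneg hupos.le (hβ p))) ?_
      split_ifs with hal
      · have h1 := hαβ a p hal.1 hal.2 hp (by
          rcases hcomp0 with hc | hc
          · exact Or.inl hc
          · exact Or.inr (by have : (0 : ℝ) ≤ a := Nat.cast_nonneg a; linarith))
        have h2 := usage_low_le_usage_zero y (T₀ + (a : ℝ) * g) j a p hy0 hy1 ht0 hal.2 hcomp0
        exact h1.trans (mul_le_mul_of_nonneg_right h2 (hβ p))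
      · exact mul_nonneg hupos.le (hβ p)
    · have : α' l = α l := by simp only [hα', if_neg hl0]
      rw [this]
      exact hαβ l p hl hlow hp hcomp
  -- it suffices to treat (α', β)
  suffices key : ∑ l ∈ Finset.range (j + 1), (if 2 * (l : ℝ) < T₀ + (a : ℝ) * g then α' l * P l else 0)
      ≤ ∑ h ∈ Finset.range (M + a + 1), (if h ≤ j ∧ 2 * (h : ℝ) < T₀ + (a : ℝ) * g then 0 else β h * P h) by
    refine le_trans (Finset.sum_le_sum fun l _ => ?_) key
    split_ifs with hlow
    · refine mul_le_mul_of_nonneg_right ?_ (hP0 l)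
      by_cases hl0 : l = 0
      · rw [hl0, hα'0]; exact hα0A
      · simp only [hα', if_neg hl0]; exact le_rfl
    · exact le_rfl
  have wd_eq := dual_functional_eq (T₀ + (a : ℝ) * g) j (M + a) α' β P (by omega)
  suffices main : ∑ p ∈ Finset.range (M + a + 1), coefAt (T₀ + (a : ℝ) * g) j α' β p * P p ≤ 0 by linarith
  -- the pulled-back prices and the single-layer layer
  set e : ℕ → ℝ := coefAt (T₀ + (a : ℝ) * g) j α' β with he
  set Φ : ℕ → ℝ := slicePullback (T₀ + (a : ℝ) * g) g j a α' β with hΦ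
  have he0 : e 0 = A := by
    simp only [he, coefAt]
    rw [if_pos ⟨Nat.zero_le j, by simpa using ht0⟩, hα'0]
  have hαa' : e a ≤ α' 0 := by
    rw [hα'0]
    simp only [he, coefAt]
    by_cases hal : a ≤ j ∧ 2 * (a : ℝ) < T₀ + (a : ℝ) * g
    · rw [if_pos hal]
      have ha0 : a ≠ 0 := by omega
      simp only [hα', if_neg ha0]
      have hite : (if a ≤ j ∧ 2 * (a : ℝ) < T₀ + (a : ℝ) * g then α a else 0) = α a := if_pos hal
      calc α a = (if a ≤ j ∧ 2 * (a : ℝ) < T₀ + (a : ℝ) * g then α a else 0) := hite.symm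
        _ ≤ A := le_max_right _ _
    · rw [if_neg hal]
      linarith [hβ a]
  obtain ⟨J, q₀, hJ1, hJ2, hJM, hq1, hqM, _hqmin, hcredit, habs, hlow⟩ :=
    slicePullback_layer y g T₀ M a j α' β hy0 hy1 hyg' hg1 ha hjN hβ hαβ'
  have hgiant : ∀ h, J + 1 ≤ h → h ≤ M → α' 0 ≤ y / (1 - y) * (- Φ h) := by
    intro h hJh hhM
    have h1 := hαβ' 0 q₀ (Nat.zero_le j) (by simpa using ht0) hqM (Or.inl hq1)
    rw [usage_giant_eq y _ j 0 q₀ hq1] at h1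
    exact h1.trans (mul_le_mul_of_nonneg_left (hcredit h hJh hhM) (div_nonneg hy0.le (by linarith)))
  -- the dichotomy
  by_cases hweak : ∃ h : ℕ, h ≤ J ∧ h ≤ M ∧ S < (h : ℝ) ∧ S * (- Φ h) < α' 0 * ((h : ℝ) - S)
  · obtain ⟨h, hhJ, hhM, hSh, hw⟩ := hweak
    have hw' : S * (- slicePullback (S + (a : ℝ) * g * (1 - z)) g j a α' β h) < α' 0 * ((h : ℝ) - S) := by
      rw [ht_eq']; exact hw
    have res := gatedSlice_weakMid_functional_le' hL y z g S a j M h ν α' β hy0 hy1 hz0 hz1 hzν hg1 hyg ha hjN hS0 hta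
      hν0 hνM hν1 hS hβ (by rw [ht_eq']; exact hαβ') (hhJ.trans hJ2) hhM hSh hw'
    rwa [ht_eq'] at res
  · push Not at hweak
    have hmain := gatedSlice_noWeak_functional_le y z g S T₀ a j M J ν α' β hy0 hy1 hzν hg0.le hS0 hT₀S ht0 hJM
      (hwin J hJ2 hJ1) hαa' habs hlow hgiant hweak
    rw [moved_functional_eq ν e M a g z hνM, he0, ← hα'0]
    have hsame : ∑ k ∈ Finset.range (M + 1), ((1 - g) * e k + g * e (k + a)) * ν k = ∑ k ∈ Finset.range (M + 1), Φ k * ν k :=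
      Finset.sum_congr rfl fun k _ => by simp only [hΦ, he, slicePullback]
    rw [hsame]
    exact hmain


/-- **the blob case of leg (III) from the corrected mixing statement**: `GatedSliceMixLaw'` ⟹ SDEC up to `Q` is closed under slicing by any heavy blob. [this work] -/
theorem sdecUpTo_slice_blob_of_mixLaw' (hL : GatedSliceMixLaw') (x Q g : ℝ) (M a : ℕ) (μ : ℕ → ℝ) (hx0 : 0 < x) (hQ1 : Q ≤ 1)
    (hQx : Q * x < 1) (hxg : x ≤ g) (hg1 : g ≤ 1) (ha : 1 ≤ a) (hμ0 : ∀ h, 0 ≤ μ h) (hμM : ∀ h, M < h → μ h = 0)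
    (hμ1 : ∑ h ∈ Finset.range (M + 1), μ h = 1)
    (hta : x * (M : ℝ) ≤ ∑ h ∈ Finset.range (M + 1), (h : ℝ) * μ h)
    (hS : SDECUpTo x Q M μ) :
    SDECUpTo x Q (M + a) (slice μ a g) :=
  sdecUpTo_slice_blob_of_window (gatedSliceWindowDEC_of_mixLaw' hL) x Q g M a μ hx0 hQ1 hQx hxg hg1 ha hμ0 hμM hμ1 hta hS

/-- **`Q = 1`**: `GatedSliceMixLaw'` ⟹ SDEC is closed under slicing by any heavy blob. [this work] -/
theorem sdec_slice_blob_of_mixLaw' (hL : GatedSliceMixLaw') (x g : ℝ) (M a : ℕ) (μ : ℕ → ℝ) (hx0 : 0 < x) (hx1 : x < 1)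
    (hxg : x ≤ g) (hg1 : g ≤ 1) (ha : 1 ≤ a) (hμ0 : ∀ h, 0 ≤ μ h) (hμM : ∀ h, M < h → μ h = 0)
    (hμ1 : ∑ h ∈ Finset.range (M + 1), μ h = 1)
    (hta : x * (M : ℝ) ≤ ∑ h ∈ Finset.range (M + 1), (h : ℝ) * μ h) (hS : SDEC x M μ) :
    SDEC x (M + a) (slice μ a g) := by
  rw [← sdecUpTo_one_iff] at hS ⊢
  exact sdecUpTo_slice_blob_of_mixLaw' hL x 1 g M a μ hx0 le_rfl (by rwa [one_mul]) hxg hg1 ha hμ0 hμM hμ1 hta hS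

end LawDec

end Quant

end Summit.CriticalPhenomena.PercolationContinuityZ3.Theorems
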